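import Literature.Computability.MetaComplexity.ParityOfModConditions
import HarnessLib

/-!
# Cell qa-qnc0, plan S2 engine (ROUND-20 §2.7–2.8): the coin-pair Cauchy–Schwarz DESCENT (DL), the termwise
Fourier leaf bound (PHI), and dead-row removal — planner qa-qnc0-p1 g21, `Sketch21.lean` §2c, statements VERBATIM

Support for crux `RingDenseResidualLt3` (stmt-QuantumAdvantage-22907), route `DWalkThree`.  The objects (all VERBATIM
from the planner's `exp21/Sketch21.lean` §2c): the `±1`-bias `bias q s B r λ` of the parity of `s` affine `MOD₃`
conditions `⟨B_k, F⟩ ≡ r_k` plus an `𝔽₂`-linear term `λ` on the coin cube `{0,1}^q`; the coin-pair data `pairVal`,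
the child systems `childB`/`childR` (survivors keep their row with the pair's columns zeroed and get the THIRD residue
`r_k + α_k(x) + α_k(x')`; non-survivors become the zero row with residue `1`); the potential `phiPot`; the three
support statements `DescentLemma` (DL), `PhiBound` (PHI), `BiasDropDead`; the computable mirror `biasNum`.

PROVED here (0 sorry):
* `descentLemma : DescentLemma` — `bias(B,r,λ)² ≤ (1/16) Σ_{x,x'∈{0,1}²} |bias(child_{x,x'}, 0)|`.  The analytic half is
  the two-coordinate Cauchy–Schwarz step `TwoModuli.sq_sum_le_sum_pair_overwrite` (Literature, [ViolaWigderson2008]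
  differencing); the cell-specific half is the SIGN LEMMA `sign_pair_overwrite`: for every `F`,
  `(−1)^{f(F^x)}·(−1)^{f(F^{x'})} = (−1)^{#surv + c_λ(x,x')} · (−1)^{#{k : ⟨childB_k,F⟩ ≡ childR_k}}` — row by row the two
  conditions of a survivor merge into the complement of the third residue (`row_pair_mod_two`, the relation (R0)), a
  non-survivor cancels, and the `λ`-term contributes a constant sign.
* `phiBound : PhiBound` — `|bias(B,r,0)| ≤ Φ(B)`; a bridge over qn-lit's
  `TwoModuli.abs_sum_negOnePow_card_filter_three_le` ([ChattopadhyayWigderson2009] Lemma 5 expansion with a parity top).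
* `biasDropDead : BiasDropDead` — a zero row with non-zero residue is never hit (`Fin.sum_univ_succAbove`).

WHAT THIS IS NOT: nothing about the crux or (P2♭′)/(P2-complete); the class version (DL-class) and BLOCK-Φ are separate
files; the certificates of Sketch21 §2b/§2c (`native_decide`) are not repeated here.
-/

namespace Summit.QuantumAdvantage.AdviceFreeQNC0

open Finset
open Literature.Computability.MetaComplexity

namespace AffBells21

/-! ## §2c statements (planner qa-qnc0-p1 g21, Sketch21.lean §2c — VERBATIM) -/

/-- The `±1`-bias of the parity of the affine MOD₃ system `(B, r)` plus the `𝔽₂`-linear term `λ`, on the whole cube `{0,1}^q`. -/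
noncomputable def bias (q s : ℕ) (B : Fin s → Fin q → ZMod 3) (r : Fin s → ZMod 3) (lam : Fin q → Bool) : ℝ :=
  (∑ F : Fin q → Bool,
      (-1 : ℝ) ^ (((univ.filter fun k : Fin s => (∑ j : Fin q, if F j then B k j else 0) = r k).card
                  + (univ.filter fun j : Fin q => lam j = true ∧ F j = true).card))) / (2 : ℝ) ^ q

/-- `α_k(x) = B_{ka} x_a + B_{kb} x_b` — the contribution of the coin pair `(a,b)` at values `x = (x_a, x_b)`. -/
def pairVal {q s : ℕ} (B : Fin s → Fin q → ZMod 3) (a b : Fin q) (k : Fin s) (x : Bool × Bool) : ZMod 3 :=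
  (if x.1 then B k a else 0) + (if x.2 then B k b else 0)

/-- Child rows: survivors keep their row with columns `a, b` zeroed; non-survivors become the zero row (made trivially false
below), so the index type `Fin s` is kept. -/
def childB {q s : ℕ} (B : Fin s → Fin q → ZMod 3) (a b : Fin q) (x x' : Bool × Bool) : Fin s → Fin q → ZMod 3 :=
  fun k j => if pairVal B a b k x ≠ pairVal B a b k x' then (if j = a ∨ j = b then 0 else B k j) else 0

/-- Child residues: the third residue `r_k + α_k(x) + α_k(x')` for survivors; `1` (never hit by the zero row) otherwise. -/
def childR {q s : ℕ} (B : Fin s → Fin q → ZMod 3) (r : Fin s → ZMod 3) (a b : Fin q) (x x' : Bool × Bool) :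
    Fin s → ZMod 3 :=
  fun k => if pairVal B a b k x ≠ pairVal B a b k x' then r k + pairVal B a b k x + pairVal B a b k x' else 1

/-- **(DL) DESCENT LEMMA** (support; elementary — Cauchy–Schwarz over the coins other than `a, b`, then (R0) on each survivor):
`bias(B,r,λ)² ≤ (1/16) Σ_{x,x' ∈ {0,1}²} |bias(child_{x,x'}, λ = 0)|`.  Note the `λ`-term disappears in the children. -/
def DescentLemma : Prop :=
  ∀ (q s : ℕ) (B : Fin s → Fin q → ZMod 3) (r : Fin s → ZMod 3) (lam : Fin q → Bool) (a b : Fin q), a ≠ b →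
    (bias q s B r lam) ^ 2
      ≤ (1 / 16 : ℝ) * ∑ x : Bool × Bool, ∑ x' : Bool × Bool,
          |bias q s (childB B a b x x') (childR B r a b x x') (fun _ => false)|

/-- The termwise Fourier potential `Φ(B) = Σ_{ξ ∈ 𝔽₃^s} 3^{−s} 2^{wt ξ} 2^{−wt(ξB)}`. -/
noncomputable def phiPot (q s : ℕ) (B : Fin s → Fin q → ZMod 3) : ℝ :=
  ∑ ξ : Fin s → ZMod 3,
    (3 : ℝ)⁻¹ ^ s * (2 : ℝ) ^ (univ.filter fun k : Fin s => ξ k ≠ 0).card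
      * ((2 : ℝ)⁻¹) ^ (univ.filter fun j : Fin q => (∑ k : Fin s, ξ k * B k j) ≠ 0).card

/-- **(PHI) BASE BOUND** (support; `(−1)^{[u≡r]} = 1/3 − (2/3)(ω^{u−r} + ω^{−(u−r)})`, `|E_F ω^{c F_j}| = |1 + ω^{c}|/2 = 1/2`
for `c ≠ 0`): with no `𝔽₂`-linear term, `|bias(B, r, 0)| ≤ Φ(B)` for all residues `r`. -/
def PhiBound : Prop :=
  ∀ (q s : ℕ) (B : Fin s → Fin q → ZMod 3) (r : Fin s → ZMod 3), |bias q s B r (fun _ => false)| ≤ phiPot q s B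

/-- NOTE for provers: `childB` keeps the index type `Fin s` and turns non-survivors into ZERO rows with residue `1` (never hit).  Such
dead rows leave `bias` unchanged (`BiasDropDead`) but inflate `phiPot` by a factor `5/3` each — so (PHI) is applied to the COMPRESSED child
(dead rows removed), never to `childB` verbatim.  (The numerics exp21/descent*.py do exactly this.) -/
def BiasDropDead : Prop :=
  ∀ (q s : ℕ) (B : Fin (s + 1) → Fin q → ZMod 3) (r : Fin (s + 1) → ZMod 3) (lam : Fin q → Bool) (k : Fin (s + 1)),
    B k = 0 → r k ≠ 0 →
      bias q (s + 1) B r lam = bias q s (fun k' => B (k.succAbove k')) (fun k' => r (k.succAbove k')) lam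

/-- Integer numerator of `bias` (computable mirror for kernel checks): `bias = biasNum / 2^q`. -/
def biasNum (q s : ℕ) (B : Fin s → Fin q → ZMod 3) (r : Fin s → ZMod 3) (lam : Fin q → Bool) : ℤ :=
  ∑ F : Fin q → Bool,
      (-1 : ℤ) ^ (((univ.filter fun k : Fin s => (∑ j : Fin q, if F j then B k j else 0) = r k).card
                  + (univ.filter fun j : Fin q => lam j = true ∧ F j = true).card))

/-- `bias = biasNum / 2^q`. -/
theorem bias_eq_biasNum (q s : ℕ) (B : Fin s → Fin q → ZMod 3) (r : Fin s → ZMod 3) (lam : Fin q → Bool) :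
    bias q s B r lam = (biasNum q s B r lam : ℝ) / (2 : ℝ) ^ q := by
  unfold bias biasNum; push_cast; rfl

/-! ## Bookkeeping: the row sums under a pair overwrite -/

variable {q s : ℕ}

/-- The `𝔽₃`-value `⟨B_k, F⟩ = Σ_j [F_j] B_{kj}` of row `k` at the coin vector `F`. -/
def rowSum (B : Fin s → Fin q → ZMod 3) (k : Fin s) (F : Fin q → Bool) : ZMod 3 :=
  ∑ j : Fin q, if F j then B k j else 0

/-- `F^x`: the coin vector `F` with the pair `(F_a, F_b)` overwritten by `x`. -/
def setPair (a b : Fin q) (x : Bool × Bool) (F : Fin q → Bool) : Fin q → Bool :=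
  Function.update (Function.update F a x.1) b x.2

/-- Row `k` with the columns `a, b` zeroed. -/
def zeroPair (B : Fin s → Fin q → ZMod 3) (a b : Fin q) : Fin s → Fin q → ZMod 3 :=
  fun k j => if j = a ∨ j = b then 0 else B k j

/-- `F^x_a = x_a` (`a ≠ b`). -/
theorem setPair_apply_left {a b : Fin q} (hab : a ≠ b) (x : Bool × Bool) (F : Fin q → Bool) :
    setPair a b x F a = x.1 := by
  unfold setPair
  rw [Function.update_of_ne hab, Function.update_self]

/-- `F^x_b = x_b`. -/
theorem setPair_apply_right (a b : Fin q) (x : Bool × Bool) (F : Fin q → Bool) :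
    setPair a b x F b = x.2 := by
  unfold setPair
  rw [Function.update_self]

/-- `F^x_j = F_j` off the pair. -/
theorem setPair_apply_of_ne {a b j : Fin q} (hja : j ≠ a) (hjb : j ≠ b) (x : Bool × Bool) (F : Fin q → Bool) :
    setPair a b x F j = F j := by
  unfold setPair
  rw [Function.update_of_ne hjb, Function.update_of_ne hja]

/-- `⟨B_k, F^x⟩ = α_k(x) + ⟨B⁰_k, F⟩` with `B⁰` the row zeroed at `a, b`. -/
theorem rowSum_setPair {a b : Fin q} (hab : a ≠ b) (B : Fin s → Fin q → ZMod 3) (k : Fin s) (x : Bool × Bool)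
    (F : Fin q → Bool) :
    rowSum B k (setPair a b x F) = pairVal B a b k x + rowSum (zeroPair B a b) k F := by
  classical
  unfold rowSum pairVal zeroPair
  have hpt : ∀ j : Fin q, (if setPair a b x F j then B k j else 0)
      = (if j = a then (if x.1 then B k a else 0) else 0) + (if j = b then (if x.2 then B k b else 0) else 0)
        + (if F j then (if j = a ∨ j = b then 0 else B k j) else 0) := by
    intro j
    by_cases hja : j = a
    · subst hja
      rw [setPair_apply_left hab]
      simp [hab]
    · by_cases hjb : j = b
      · subst hjb
        rw [setPair_apply_right]
        simp [hja]
      · rw [setPair_apply_of_ne hja hjb]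
        simp [hja, hjb]
  rw [sum_congr rfl fun j _ => hpt j, sum_add_distrib, sum_add_distrib, sum_ite_eq' univ a, sum_ite_eq' univ b]
  simp

/-- `⟨childB_k, F⟩ = ⟨B⁰_k, F⟩` for a survivor, `0` otherwise. -/
theorem rowSum_childB (B : Fin s → Fin q → ZMod 3) (a b : Fin q) (x x' : Bool × Bool) (k : Fin s) (F : Fin q → Bool) :
    rowSum (childB B a b x x') k F
      = if pairVal B a b k x ≠ pairVal B a b k x' then rowSum (zeroPair B a b) k F else 0 := by
  unfold rowSum childB zeroPair
  split_ifs with h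
  · rfl
  · simp

/-- (R0) row by row: for a survivor (`α ≠ α'`) the two conditions `α + u ≡ r`, `α' + u ≡ r` have the parity of
`1 + [u ≡ r + α + α']` (the complement of the third residue); a non-survivor cancels. -/
theorem row_pair_mod_two (α α' u r : ZMod 3) :
    ((if α + u = r then 1 else 0) + (if α' + u = r then 1 else 0) : ℕ) % 2
      = ((if α ≠ α' then 1 else 0)
          + (if (if α ≠ α' then u else 0) = (if α ≠ α' then r + α + α' else 1) then 1 else 0) : ℕ) % 2 := by
  revert α α' u r
  decide

/-- `(−1)^m = (−1)^n` when `m ≡ n (mod 2)`. -/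
theorem neg_one_pow_congr_mod_two {m n : ℕ} (h : m % 2 = n % 2) : (-1 : ℝ) ^ m = (-1 : ℝ) ^ n := by
  rw [neg_one_pow_eq_pow_mod_two, h, ← neg_one_pow_eq_pow_mod_two]

/-- The number of survivors of the pair move `(x, x')`. -/
def survCount (B : Fin s → Fin q → ZMod 3) (a b : Fin q) (x x' : Bool × Bool) : ℕ :=
  (univ.filter fun k : Fin s => pairVal B a b k x ≠ pairVal B a b k x').card

/-- The constant `λ`-parity of the pair move: `[λ_a ∧ x_a] + [λ_a ∧ x'_a] + [λ_b ∧ x_b] + [λ_b ∧ x'_b]`. -/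
def lamCount (lam : Fin q → Bool) (a b : Fin q) (x x' : Bool × Bool) : ℕ :=
  ((if lam a = true ∧ x.1 = true then 1 else 0) + (if lam a = true ∧ x'.1 = true then 1 else 0))
    + ((if lam b = true ∧ x.2 = true then 1 else 0) + (if lam b = true ∧ x'.2 = true then 1 else 0))

/-- Row bookkeeping of the pair move: `#hit(F^x) + #hit(F^{x'}) ≡ #surv + #hit_child(F) (mod 2)`. -/
theorem card_rows_setPair_mod_two {a b : Fin q} (hab : a ≠ b) (B : Fin s → Fin q → ZMod 3) (r : Fin s → ZMod 3)
    (x x' : Bool × Bool) (F : Fin q → Bool) :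
    ((univ.filter fun k : Fin s => rowSum B k (setPair a b x F) = r k).card
        + (univ.filter fun k : Fin s => rowSum B k (setPair a b x' F) = r k).card) % 2
      = (survCount B a b x x'
          + (univ.filter fun k : Fin s => rowSum (childB B a b x x') k F = childR B r a b x x' k).card) % 2 := by
  unfold survCount
  rw [card_filter, card_filter, card_filter, card_filter, ← sum_add_distrib, ← sum_add_distrib, Finset.sum_nat_mod,
    Finset.sum_nat_mod (univ : Finset (Fin s)) 2 (fun k => _ + _)]
  congr 1
  refine sum_congr rfl fun k _ => ?_
  rw [rowSum_setPair hab, rowSum_setPair hab, rowSum_childB]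
  unfold childR
  exact row_pair_mod_two _ _ _ _

/-- `λ` bookkeeping of the pair move: `#{λ ∧ F^x} + #{λ ∧ F^{x'}} ≡ c_λ(x,x') (mod 2)`. -/
theorem card_lam_setPair_mod_two {a b : Fin q} (hab : a ≠ b) (lam : Fin q → Bool) (x x' : Bool × Bool)
    (F : Fin q → Bool) :
    ((univ.filter fun j : Fin q => lam j = true ∧ setPair a b x F j = true).card
        + (univ.filter fun j : Fin q => lam j = true ∧ setPair a b x' F j = true).card) % 2
      = lamCount lam a b x x' % 2 := by
  classical
  have hpt : ∀ j : Fin q,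
      ((if lam j = true ∧ setPair a b x F j = true then 1 else 0)
          + (if lam j = true ∧ setPair a b x' F j = true then 1 else 0) : ℕ) % 2
        = ((if j = a then ((if lam a = true ∧ x.1 = true then 1 else 0) + (if lam a = true ∧ x'.1 = true then 1 else 0))
              else 0)
            + (if j = b then ((if lam b = true ∧ x.2 = true then 1 else 0) + (if lam b = true ∧ x'.2 = true then 1 else 0))
              else 0) : ℕ) % 2 := by
    intro j
    by_cases hja : j = a
    · subst hja
      rw [setPair_apply_left hab, setPair_apply_left hab]
      simp [hab]
    · by_cases hjb : j = b
      · subst hjb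
        rw [setPair_apply_right, setPair_apply_right]
        simp [hja]
      · rw [setPair_apply_of_ne hja hjb, setPair_apply_of_ne hja hjb]
        simp only [hja, hjb, if_false, add_zero]
        split_ifs <;> simp
  unfold lamCount
  rw [card_filter, card_filter, ← sum_add_distrib, Finset.sum_nat_mod, sum_congr rfl fun j _ => hpt j,
    ← Finset.sum_nat_mod, sum_add_distrib, sum_ite_eq' univ a, sum_ite_eq' univ b]
  simp

/-- The summand of `bias` in `rowSum` form. -/
theorem bias_eq_sum_rowSum (B : Fin s → Fin q → ZMod 3) (r : Fin s → ZMod 3) (lam : Fin q → Bool) :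
    bias q s B r lam
      = (∑ F : Fin q → Bool, (-1 : ℝ) ^ ((univ.filter fun k : Fin s => rowSum B k F = r k).card
          + (univ.filter fun j : Fin q => lam j = true ∧ F j = true).card)) / (2 : ℝ) ^ q := rfl

/-- **SIGN LEMMA** of the pair move: for every `F`,
`(−1)^{f(F^x)} (−1)^{f(F^{x'})} = (−1)^{#surv + c_λ} (−1)^{#hit_child(F) + 0}` — the cross term of the two-coordinate
Cauchy–Schwarz is `±` the summand of the child bias (with `λ = 0`). -/
theorem sign_pair_overwrite {a b : Fin q} (hab : a ≠ b) (B : Fin s → Fin q → ZMod 3) (r : Fin s → ZMod 3)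
    (lam : Fin q → Bool) (x x' : Bool × Bool) (F : Fin q → Bool) :
    (-1 : ℝ) ^ ((univ.filter fun k : Fin s => rowSum B k (setPair a b x F) = r k).card
          + (univ.filter fun j : Fin q => lam j = true ∧ setPair a b x F j = true).card)
        * (-1 : ℝ) ^ ((univ.filter fun k : Fin s => rowSum B k (setPair a b x' F) = r k).card
          + (univ.filter fun j : Fin q => lam j = true ∧ setPair a b x' F j = true).card)
      = (-1 : ℝ) ^ (survCount B a b x x' + lamCount lam a b x x')
        * (-1 : ℝ) ^ ((univ.filter fun k : Fin s => rowSum (childB B a b x x') k F = childR B r a b x x' k).card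
            + (univ.filter fun j : Fin q => (fun _ : Fin q => false) j = true ∧ F j = true).card) := by
  have hempty : (univ.filter fun j : Fin q => (fun _ : Fin q => false) j = true ∧ F j = true).card = 0 := by
    rw [Finset.card_eq_zero, Finset.filter_eq_empty_iff]
    intro j _ h
    exact Bool.false_ne_true h.1
  rw [hempty, add_zero, ← pow_add, ← pow_add]
  apply neg_one_pow_congr_mod_two
  have h1 := card_rows_setPair_mod_two hab B r x x' F
  have h2 := card_lam_setPair_mod_two hab lam x x' F
  omega

/-- The cross term of the pair move is `±` the child bias:
`Σ_F f(F^x) f(F^{x'}) = (−1)^{#surv + c_λ} · 2^q · bias(child_{x,x'}, 0)`. -/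
theorem sum_pair_overwrite_eq {a b : Fin q} (hab : a ≠ b) (B : Fin s → Fin q → ZMod 3) (r : Fin s → ZMod 3)
    (lam : Fin q → Bool) (x x' : Bool × Bool) :
    ∑ F : Fin q → Bool,
        (-1 : ℝ) ^ ((univ.filter fun k : Fin s => rowSum B k (setPair a b x F) = r k).card
            + (univ.filter fun j : Fin q => lam j = true ∧ setPair a b x F j = true).card)
          * (-1 : ℝ) ^ ((univ.filter fun k : Fin s => rowSum B k (setPair a b x' F) = r k).card
            + (univ.filter fun j : Fin q => lam j = true ∧ setPair a b x' F j = true).card)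
      = (-1 : ℝ) ^ (survCount B a b x x' + lamCount lam a b x x')
        * ((2 : ℝ) ^ q * bias q s (childB B a b x x') (childR B r a b x x') (fun _ => false)) := by
  rw [sum_congr rfl fun F _ => sign_pair_overwrite hab B r lam x x' F, ← mul_sum, bias_eq_sum_rowSum,
    mul_div_cancel₀ _ (by positivity)]

/-! ## (DL) the descent lemma -/

/-- **(DL) PROVED**: `bias(B,r,λ)² ≤ (1/16) Σ_{x,x' ∈ {0,1}²} |bias(child_{x,x'}, 0)|`
(two-coordinate Cauchy–Schwarz `TwoModuli.sq_sum_le_sum_pair_overwrite` + the sign lemma). -/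
theorem descentLemma : DescentLemma := by
  intro q s B r lam a b hab
  set f : (Fin q → Bool) → ℝ := fun F => (-1 : ℝ) ^ ((univ.filter fun k : Fin s => rowSum B k F = r k).card
      + (univ.filter fun j : Fin q => lam j = true ∧ F j = true).card) with hf
  have hbias : bias q s B r lam = (∑ F, f F) / (2 : ℝ) ^ q := rfl
  have hCS := TwoModuli.sq_sum_le_sum_pair_overwrite f hab
  rw [Fintype.card_fin] at hCS
  have hcross : ∀ x x' : Bool × Bool,
      ∑ F : Fin q → Bool, f (Function.update (Function.update F a x.1) b x.2)
          * f (Function.update (Function.update F a x'.1) b x'.2)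
        = (-1 : ℝ) ^ (survCount B a b x x' + lamCount lam a b x x')
          * ((2 : ℝ) ^ q * bias q s (childB B a b x x') (childR B r a b x x') (fun _ => false)) :=
    fun x x' => sum_pair_overwrite_eq hab B r lam x x'
  simp_rw [hcross] at hCS
  have h2q : (0 : ℝ) < (2 : ℝ) ^ q := by positivity
  rw [hbias, div_pow, div_le_iff₀ (by positivity)]
  calc (∑ F, f F) ^ 2
      ≤ 2 ^ q / 16 * ∑ x : Bool × Bool, ∑ x' : Bool × Bool,
          (-1 : ℝ) ^ (survCount B a b x x' + lamCount lam a b x x')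
            * ((2 : ℝ) ^ q * bias q s (childB B a b x x') (childR B r a b x x') (fun _ => false)) := hCS
    _ ≤ 2 ^ q / 16 * ∑ x : Bool × Bool, ∑ x' : Bool × Bool,
          ((2 : ℝ) ^ q * |bias q s (childB B a b x x') (childR B r a b x x') (fun _ => false)|) := by
        apply mul_le_mul_of_nonneg_left _ (by positivity)
        refine sum_le_sum fun x _ => sum_le_sum fun x' _ => ?_
        refine le_trans (le_abs_self _) ?_
        rw [abs_mul, abs_neg_one_pow, one_mul, abs_mul, abs_of_pos h2q]
    _ = 1 / 16 * (∑ x : Bool × Bool, ∑ x' : Bool × Bool,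
          |bias q s (childB B a b x x') (childR B r a b x x') (fun _ => false)|) * ((2 : ℝ) ^ q) ^ 2 := by
        simp_rw [← mul_sum]
        ring

/-! ## (PHI) the termwise Fourier bound -/

/-- **(PHI) PROVED**: `|bias(B, r, 0)| ≤ Φ(B)` — qn-lit's `TwoModuli.abs_sum_negOnePow_card_filter_three_le`
([ChattopadhyayWigderson2009] Lemma 5 display (5) with a parity top) divided by `2^q`. -/
theorem phiBound : PhiBound := by
  intro q s B r
  have h := TwoModuli.abs_sum_negOnePow_card_filter_three_le B r
  rw [Fintype.card_fin, Fintype.card_fin] at h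
  have hsum : (∑ F : Fin q → Bool,
      (-1 : ℝ) ^ (((univ.filter fun k : Fin s => (∑ j : Fin q, if F j then B k j else 0) = r k).card
                  + (univ.filter fun j : Fin q => (fun _ : Fin q => false) j = true ∧ F j = true).card)))
      = ∑ F : Fin q → Bool, (-1 : ℝ) ^ (univ.filter fun k : Fin s => (∑ j : Fin q, if F j then B k j else 0) = r k).card := by
    refine sum_congr rfl fun F _ => ?_
    have hempty : (univ.filter fun j : Fin q => (fun _ : Fin q => false) j = true ∧ F j = true).card = 0 := by
      rw [Finset.card_eq_zero, Finset.filter_eq_empty_iff]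
      intro j _ h
      exact Bool.false_ne_true h.1
    rw [hempty, add_zero]
  unfold bias phiPot
  rw [hsum, abs_div, abs_of_pos (by positivity : (0 : ℝ) < 2 ^ q), div_le_iff₀ (by positivity)]
  calc _ ≤ _ := h
    _ = _ := by rw [mul_comm]

/-! ## Dead rows -/

/-- **`BiasDropDead` PROVED**: a zero row with residue `≠ 0` is never hit, so deleting it leaves `bias` unchanged. -/
theorem biasDropDead : BiasDropDead := by
  intro q s B r lam k hB hr
  unfold bias
  congr 1
  refine sum_congr rfl fun F _ => ?_
  congr 2
  rw [card_filter, card_filter, Fin.sum_univ_succAbove _ k]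
  have hk : ¬ ((∑ j : Fin q, if F j then B k j else 0) = r k) := by
    rw [hB]
    simp only [Pi.zero_apply, ite_self, sum_const_zero]
    exact fun h => hr h.symm
  rw [if_neg hk, zero_add]

end AffBells21

end Summit.QuantumAdvantage.AdviceFreeQNC0
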